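import Summits.AtomisticToContinuum.FouriersLaw.Theorems.JunctionLocalityNonBallisticLightConeMomentumTail
import HarnessLib

/-!
# The boundary autocorrelation as an integral over `Gibbs ⊗ Wiener`, and its Gaussian moment inputs

Helper file (`--supports stmt-AtomisticToContinuum-12240`, item `HalfChainLocality` of route
`BoundaryEscapeDeficit`, sub-problem `FouriersLaw`). For `P = pinnedChain ω₂ lam β γ` (`ω₂ > 0`,
`lam, β, γ ≥ 0`), `T > 0`, `n ≥ 1`, the boundary observable `A(x) = p_k(x)² - T`, the Gibbs measure
`μ_n = gibbsMeasure n T`, the Brownian pair `W = wienerPair` and the solution map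
`Φ_r(x, Bω) = solMap n T T r x (pairPath ω)`:

* `pinnedChain_integral_kinObs_sq`, `pinnedChain_integral_kinObs_pow_four` — `∫ A² dμ_n = 2T²`,
  `∫ A⁴ dμ_n = 60T⁴` (Gaussian momentum marginal; `commonPastBound_gibbsEvenMoments`), INDEPENDENT of `n`
  and of the site; `lintegral` forms `…_lintegral_…`;
* `pinnedChain_lintegral_fst_prod_wiener` — `∫ f(q.1) d(μ ⊗ W) = ∫ f dμ`;
* `pinnedChain_integrable_kinObsProd` — `Y(x, ω) = A(x) A(Φ_r(x, Bω))` is `μ_n ⊗ W`-integrable;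
* `pinnedChain_kinCorr_eq_integral_prod` (**main**) — the route's kernel-form autocorrelation
  `K_n(u) = ∫ A(x) (∫ A dP_{u⁺}(x, ·)) dμ_n(x)` equals `∫ Y d(μ_n ⊗ W)` with `r = u⁺`.

Folklore; no definitions.
-/

noncomputable section

open MeasureTheory ProbabilityTheory Set Filter Topology
open scoped NNReal ENNReal

namespace Summit.AtomisticToContinuum.FouriersLaw.Theorems.HalfChainLocality

open Literature.MathematicalPhysics.KineticTheory Literature.MathematicalPhysics.KineticTheory.HeatConduction
open Literature.Probability.Process OscillatorChain
open Summit.AtomisticToContinuum.FouriersLaw.Theorems.PhononMeanFreePath (commonPastBound_gibbsEvenMoments)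
open Summit.AtomisticToContinuum.FouriersLaw.Theorems.NonBallistic

variable {ω₂ lam β γ T : ℝ} {n : ℕ}

section Statics

variable (hω : 0 < ω₂) (hl : 0 ≤ lam) (hβ : 0 ≤ β) (γ : ℝ) (hT : 0 < T)
include hω hl hβ hT

/-- The even momentum moments `∫ p_k^{2m} dμ_n` for `m = 0, …, 4`: `1, T, 3T², 15T³, 105T⁴`, with
integrability. [folklore] -/
theorem pinnedChain_momentum_moments (k : Fin n) :
    (Integrable (fun x : PhaseSpace n => x.2 k ^ 2) ((pinnedChain ω₂ lam β γ).gibbsMeasure n T) ∧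
      ∫ x, x.2 k ^ 2 ∂((pinnedChain ω₂ lam β γ).gibbsMeasure n T) = T) ∧
    (Integrable (fun x : PhaseSpace n => x.2 k ^ 4) ((pinnedChain ω₂ lam β γ).gibbsMeasure n T) ∧
      ∫ x, x.2 k ^ 4 ∂((pinnedChain ω₂ lam β γ).gibbsMeasure n T) = 3 * T ^ 2) ∧
    (Integrable (fun x : PhaseSpace n => x.2 k ^ 6) ((pinnedChain ω₂ lam β γ).gibbsMeasure n T) ∧
      ∫ x, x.2 k ^ 6 ∂((pinnedChain ω₂ lam β γ).gibbsMeasure n T) = 15 * T ^ 3) ∧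
    (Integrable (fun x : PhaseSpace n => x.2 k ^ 8) ((pinnedChain ω₂ lam β γ).gibbsMeasure n T) ∧
      ∫ x, x.2 k ^ 8 ∂((pinnedChain ω₂ lam β γ).gibbsMeasure n T) = 105 * T ^ 4) := by
  have h := fun m : ℕ => commonPastBound_gibbsEvenMoments ω₂ lam β γ hω hl hβ T hT n k m
  have h1 := h 1; have h2 := h 2; have h3 := h 3; have h4 := h 4
  simp only [Finset.prod_range_succ, Finset.prod_range_zero, Nat.cast_zero, Nat.cast_one, Nat.cast_ofNat] at h1 h2 h3 h4
  norm_num at h1 h2 h3 h4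
  refine ⟨⟨h1.1, h1.2⟩, ⟨h2.1, by rw [h2.2]; ring⟩, ⟨h3.1, by rw [h3.2]; ring⟩, ⟨h4.1, by rw [h4.2]; ring⟩⟩

/-- **`∫ (p_k² - T)² dμ_n = 2T²`** (the equilibrium variance of the kinetic observable; independent of
`n` and `k`). [folklore] -/
theorem pinnedChain_integral_kinObs_sq (k : Fin n) :
    Integrable (fun x : PhaseSpace n => (x.2 k ^ 2 - T) ^ 2) ((pinnedChain ω₂ lam β γ).gibbsMeasure n T) ∧
      ∫ x, (x.2 k ^ 2 - T) ^ 2 ∂((pinnedChain ω₂ lam β γ).gibbsMeasure n T) = 2 * T ^ 2 := by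
  haveI := pinnedChain_isProbabilityMeasure_gibbsMeasure hω hl hβ γ n hT
  obtain ⟨⟨i2, e2⟩, ⟨i4, e4⟩, -, -⟩ := pinnedChain_momentum_moments hω hl hβ γ hT k
  have e : (fun x : PhaseSpace n => (x.2 k ^ 2 - T) ^ 2) = fun x => x.2 k ^ 4 - 2 * T * x.2 k ^ 2 + T ^ 2 := by
    funext x; ring
  rw [e]
  have i22 : Integrable (fun x : PhaseSpace n => 2 * T * x.2 k ^ 2) ((pinnedChain ω₂ lam β γ).gibbsMeasure n T) :=
    i2.const_mul _
  have iS : Integrable (fun x : PhaseSpace n => x.2 k ^ 4 - 2 * T * x.2 k ^ 2) ((pinnedChain ω₂ lam β γ).gibbsMeasure n T) :=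
    i4.sub i22
  refine ⟨iS.add (integrable_const _), ?_⟩
  rw [integral_add iS (integrable_const _), integral_sub i4 i22, integral_const_mul, integral_const, e4, e2]
  simp only [probReal_univ, smul_eq_mul, one_mul]
  ring

/-- **`∫ (p_k² - T)⁴ dμ_n = 60T⁴`** (independent of `n` and `k`). [folklore] -/
theorem pinnedChain_integral_kinObs_pow_four (k : Fin n) :
    Integrable (fun x : PhaseSpace n => (x.2 k ^ 2 - T) ^ 4) ((pinnedChain ω₂ lam β γ).gibbsMeasure n T) ∧
      ∫ x, (x.2 k ^ 2 - T) ^ 4 ∂((pinnedChain ω₂ lam β γ).gibbsMeasure n T) = 60 * T ^ 4 := by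
  haveI := pinnedChain_isProbabilityMeasure_gibbsMeasure hω hl hβ γ n hT
  obtain ⟨⟨i2, e2⟩, ⟨i4, e4⟩, ⟨i6, e6⟩, ⟨i8, e8⟩⟩ := pinnedChain_momentum_moments hω hl hβ γ hT k
  have e : (fun x : PhaseSpace n => (x.2 k ^ 2 - T) ^ 4) =
      fun x => x.2 k ^ 8 - 4 * T * x.2 k ^ 6 + 6 * T ^ 2 * x.2 k ^ 4 - 4 * T ^ 3 * x.2 k ^ 2 + T ^ 4 := by
    funext x; ring
  rw [e]
  set μ := (pinnedChain ω₂ lam β γ).gibbsMeasure n T with hμ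
  have i6' : Integrable (fun x : PhaseSpace n => 4 * T * x.2 k ^ 6) μ := i6.const_mul _
  have i4' : Integrable (fun x : PhaseSpace n => 6 * T ^ 2 * x.2 k ^ 4) μ := i4.const_mul _
  have i2' : Integrable (fun x : PhaseSpace n => 4 * T ^ 3 * x.2 k ^ 2) μ := i2.const_mul _
  have iA : Integrable (fun x : PhaseSpace n => x.2 k ^ 8 - 4 * T * x.2 k ^ 6) μ := i8.sub i6'
  have iB : Integrable (fun x : PhaseSpace n => x.2 k ^ 8 - 4 * T * x.2 k ^ 6 + 6 * T ^ 2 * x.2 k ^ 4) μ := iA.add i4'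
  have iC : Integrable (fun x : PhaseSpace n => x.2 k ^ 8 - 4 * T * x.2 k ^ 6 + 6 * T ^ 2 * x.2 k ^ 4 -
      4 * T ^ 3 * x.2 k ^ 2) μ := iB.sub i2'
  refine ⟨iC.add (integrable_const _), ?_⟩
  rw [integral_add iC (integrable_const _), integral_sub iB i2', integral_add iA i4', integral_sub i8 i6',
    integral_const_mul, integral_const_mul, integral_const_mul, integral_const, e8, e6, e4, e2]
  simp only [probReal_univ, smul_eq_mul, one_mul]
  ring

/-- `lintegral` forms: `∫ ofReal (p_k²) dμ_n = T`, `∫ ofReal ((p_k²-T)²) dμ_n = 2T²`,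
`∫ ofReal ((p_k²-T)⁴) dμ_n = 60T⁴`. [folklore] -/
theorem pinnedChain_lintegral_kinObs_moments (k : Fin n) :
    ∫⁻ x, ENNReal.ofReal (x.2 k ^ 2) ∂((pinnedChain ω₂ lam β γ).gibbsMeasure n T) = ENNReal.ofReal T ∧
    ∫⁻ x, ENNReal.ofReal ((x.2 k ^ 2 - T) ^ 2) ∂((pinnedChain ω₂ lam β γ).gibbsMeasure n T) = ENNReal.ofReal (2 * T ^ 2) ∧
    ∫⁻ x, ENNReal.ofReal ((x.2 k ^ 2 - T) ^ 4) ∂((pinnedChain ω₂ lam β γ).gibbsMeasure n T) = ENNReal.ofReal (60 * T ^ 4) := by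
  obtain ⟨⟨i2, e2⟩, -, -, -⟩ := pinnedChain_momentum_moments hω hl hβ γ hT k
  obtain ⟨iA, eA⟩ := pinnedChain_integral_kinObs_sq hω hl hβ γ hT k
  obtain ⟨iB, eB⟩ := pinnedChain_integral_kinObs_pow_four hω hl hβ γ hT k
  refine ⟨?_, ?_, ?_⟩
  · rw [← ofReal_integral_eq_lintegral_ofReal i2 (Eventually.of_forall fun x => sq_nonneg _), e2]
  · rw [← ofReal_integral_eq_lintegral_ofReal iA (Eventually.of_forall fun x => sq_nonneg _), eA]
  · rw [← ofReal_integral_eq_lintegral_ofReal iB (Eventually.of_forall fun x => by positivity), eB]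

end Statics

/-! ### The autocorrelation as an integral over the product `Gibbs ⊗ Wiener` -/

section Product

variable (hω : 0 < ω₂) (hl : 0 ≤ lam) (hβ : 0 ≤ β) (hγ : 0 ≤ γ) (hn : 0 < n) (hT : 0 < T)
include hω hl hβ hγ hn hT

omit hω hl hβ hγ hn hT in
/-- Functions of the initial condition only: `∫ f(q.1) d(μ_n ⊗ W) = ∫ f dμ_n` (`W` is a probability
measure). [folklore] -/
theorem pinnedChain_lintegral_fst_prod_wiener {f : PhaseSpace n → ℝ≥0∞} (hf : Measurable f) :
    ∫⁻ q, f q.1 ∂(((pinnedChain ω₂ lam β γ).gibbsMeasure n T).prod wienerPair) =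
      ∫⁻ x, f x ∂((pinnedChain ω₂ lam β γ).gibbsMeasure n T) := by
  rw [lintegral_prod (f := fun q : PhaseSpace n × WienerPair => f q.1) (hf.comp measurable_fst).aemeasurable]
  refine lintegral_congr fun x => ?_
  show ∫⁻ _ω, f x ∂wienerPair = f x
  rw [lintegral_const, measure_univ, mul_one]

/-- **`L¹` bound for the autocorrelation integrand** `Y(x, ω) = (p_k(x)² - T)(p_k(Φ_r(x, Bω))² - T)`:
`∫ ‖Y‖ d(μ_n ⊗ W) ≤ 2T² + 2T²` (`|ab| ≤ a² + b²`, statics, stationarity), and `Y` is measurable.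
[folklore] -/
theorem pinnedChain_lintegral_enorm_kinObsProd_le (r : ℝ) (k : Fin n) :
    Measurable (fun q : PhaseSpace n × WienerPair => (q.1.2 k ^ 2 - T) *
        (((pinnedChain ω₂ lam β γ).solMap n T T r q.1 (pairPath q.2)).2 k ^ 2 - T)) ∧
    ∫⁻ q, ‖(q.1.2 k ^ 2 - T) * (((pinnedChain ω₂ lam β γ).solMap n T T r q.1 (pairPath q.2)).2 k ^ 2 - T)‖ₑ
        ∂(((pinnedChain ω₂ lam β γ).gibbsMeasure n T).prod wienerPair) ≤
      ENNReal.ofReal (2 * T ^ 2) + ENNReal.ofReal (2 * T ^ 2) := by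
  set P := pinnedChain ω₂ lam β γ with hP
  have hΦ : Measurable fun q : PhaseSpace n × WienerPair => P.solMap n T T r q.1 (pairPath q.2) :=
    pinnedChain_measurable_solMap_pairPath hω hl hβ hγ n T T r
  have hA : Measurable fun z : PhaseSpace n => z.2 k ^ 2 - T := by fun_prop
  have hmeas : Measurable fun q : PhaseSpace n × WienerPair => (q.1.2 k ^ 2 - T) *
      ((P.solMap n T T r q.1 (pairPath q.2)).2 k ^ 2 - T) := (hA.comp measurable_fst).mul (hA.comp hΦ)
  refine ⟨hmeas, ?_⟩
  obtain ⟨-, e2, -⟩ := pinnedChain_lintegral_kinObs_moments hω hl hβ γ hT k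
  have h1 : ∫⁻ q, ENNReal.ofReal ((q.1.2 k ^ 2 - T) ^ 2) ∂((P.gibbsMeasure n T).prod wienerPair) =
      ENNReal.ofReal (2 * T ^ 2) := by
    rw [pinnedChain_lintegral_fst_prod_wiener (f := fun z => ENNReal.ofReal ((z.2 k ^ 2 - T) ^ 2))
      ((hA.pow_const 2).ennreal_ofReal), e2]
  have h2 : ∫⁻ q, ENNReal.ofReal (((P.solMap n T T r q.1 (pairPath q.2)).2 k ^ 2 - T) ^ 2)
      ∂((P.gibbsMeasure n T).prod wienerPair) = ENNReal.ofReal (2 * T ^ 2) := by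
    rw [pinnedChain_lintegral_prod_solMap_gibbs hω hl hβ hγ (N := n) hn hT r (g := fun z => ENNReal.ofReal ((z.2 k ^ 2 - T) ^ 2))
      ((hA.pow_const 2).ennreal_ofReal), e2]
  calc ∫⁻ q, ‖(q.1.2 k ^ 2 - T) * ((P.solMap n T T r q.1 (pairPath q.2)).2 k ^ 2 - T)‖ₑ
        ∂((P.gibbsMeasure n T).prod wienerPair)
      ≤ ∫⁻ q, (ENNReal.ofReal ((q.1.2 k ^ 2 - T) ^ 2) +
          ENNReal.ofReal (((P.solMap n T T r q.1 (pairPath q.2)).2 k ^ 2 - T) ^ 2))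
          ∂((P.gibbsMeasure n T).prod wienerPair) := by
        refine lintegral_mono fun q => ?_
        rw [Real.enorm_eq_ofReal_abs, ← ENNReal.ofReal_add (sq_nonneg _) (sq_nonneg _)]
        refine ENNReal.ofReal_le_ofReal ?_
        rw [abs_mul]
        nlinarith [sq_nonneg (|q.1.2 k ^ 2 - T| - |(P.solMap n T T r q.1 (pairPath q.2)).2 k ^ 2 - T|),
          sq_abs (q.1.2 k ^ 2 - T), sq_abs ((P.solMap n T T r q.1 (pairPath q.2)).2 k ^ 2 - T)]
    _ = ENNReal.ofReal (2 * T ^ 2) + ENNReal.ofReal (2 * T ^ 2) := by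
        have hm1 : Measurable fun q : PhaseSpace n × WienerPair => ENNReal.ofReal ((q.1.2 k ^ 2 - T) ^ 2) :=
          ((hA.comp measurable_fst).pow_const 2).ennreal_ofReal
        rw [lintegral_add_left hm1, h1, h2]

/-- **Integrability of the autocorrelation integrand** `Y(x, ω) = (p_k(x)² - T)(p_k(Φ_r(x, Bω))² - T)`
under `μ_n ⊗ W`. [folklore] -/
theorem pinnedChain_integrable_kinObsProd (r : ℝ) (k : Fin n) :
    Integrable (fun q : PhaseSpace n × WienerPair => (q.1.2 k ^ 2 - T) *
        (((pinnedChain ω₂ lam β γ).solMap n T T r q.1 (pairPath q.2)).2 k ^ 2 - T))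
      (((pinnedChain ω₂ lam β γ).gibbsMeasure n T).prod wienerPair) := by
  obtain ⟨hmeas, hle⟩ := pinnedChain_lintegral_enorm_kinObsProd_le hω hl hβ hγ hn hT r k
  exact ⟨hmeas.aestronglyMeasurable, hasFiniteIntegral_iff_enorm.2
    (hle.trans_lt (ENNReal.add_lt_top.2 ⟨ENNReal.ofReal_lt_top, ENNReal.ofReal_lt_top⟩))⟩

/-- **The boundary autocorrelation as a product integral.** For every real `u` and site `k`,
`∫ (p_k² - T)(x) (∫ (p_k² - T) dP_{u⁺}(x, ·)) dμ_n(x) = ∫ (p_k²-T)(x) (p_k²-T)(Φ_{u⁺}(x, Bω)) d(μ_n ⊗ W)(x, ω)`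
(the constructed kernel is the law of the solution map, then Fubini). [folklore] -/
theorem pinnedChain_kinCorr_eq_integral_prod (u : ℝ) (k : Fin n) :
    ∫ x, (x.2 k ^ 2 - T) * (∫ y, (y.2 k ^ 2 - T) ∂((pinnedChain ω₂ lam β γ).transitionKernel n T T u.toNNReal x))
        ∂((pinnedChain ω₂ lam β γ).gibbsMeasure n T) =
      ∫ q, (q.1.2 k ^ 2 - T) *
          (((pinnedChain ω₂ lam β γ).solMap n T T ((u.toNNReal : ℝ≥0) : ℝ) q.1 (pairPath q.2)).2 k ^ 2 - T)
        ∂(((pinnedChain ω₂ lam β γ).gibbsMeasure n T).prod wienerPair) := by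
  haveI := pinnedChain_isProbabilityMeasure_gibbsMeasure hω hl hβ γ n hT
  set P := pinnedChain ω₂ lam β γ with hP
  have hA : Continuous fun z : PhaseSpace n => z.2 k ^ 2 - T := by fun_prop
  have hinner : ∀ x, ∫ y, (y.2 k ^ 2 - T) ∂(P.transitionKernel n T T u.toNNReal x) =
      ∫ ω, ((P.solMap n T T ((u.toNNReal : ℝ≥0) : ℝ) x (pairPath ω)).2 k ^ 2 - T) ∂wienerPair := fun x =>
    pinnedChain_integral_transitionKernel hω hl hβ hγ n T T u.toNNReal x hA.aestronglyMeasurable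
  simp_rw [hinner]
  rw [integral_prod _ (pinnedChain_integrable_kinObsProd hω hl hβ hγ hn hT _ k)]
  refine integral_congr_ae (Eventually.of_forall fun x => ?_)
  exact (integral_const_mul _ _).symm

end Product

end Summit.AtomisticToContinuum.FouriersLaw.Theorems.HalfChainLocality

end
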